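import Summits.NavierStokesRegularity.FunctionalMining.TopEigRayleigh
import Summits.NavierStokesRegularity.FunctionalMining.TopEigHeatCoerciveSymm
import Literature.Analysis.Matrix.KyFanMaximumPrinciple
import HarnessLib

/-!
# FunctionalMining — the top Rayleigh value IS the largest eigenvalue; coercivity on trace-free `3 × 3`

Search for candidate a priori estimates; no regularity claim. Cell `pub-nsfunc`, prove seat
(gen 16). Continuation of `TopEigRayleigh`:

* `TopEig.lam_eq_eigenvalues₀` — for a symmetric flattened tensor `A` (matrix `M`, `A(i,j) = Mᵢⱼ`),
  `λ(A) = λ_1↓(M)`, Mathlib's largest sorted eigenvalue (`Matrix.IsHermitian.eigenvalues₀` at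
  index `0`); the two inequalities are the tree's Rayleigh bound
  `Literature.Analysis.Matrix.KyFan.dotProduct_mulVec_le_eigenvalues₀_max_mul` (Horn–Johnson
  Thm. 4.2.2 (c)) and its attainment `KyFan.exists_frame_sum_rayleigh_eq` (`k = 1`);
* `TopEig.lam_strainFlat` — hence `λ(strainFlat v x) = torusStrainTopEig v x`, the dictionary's
  `λ₁` density of `StrainEigen.lean` (`⨆` of the sorted spectrum = its value at index `0`);
* `TopEig.norm_le_six_mul_lam` — COERCIVITY on trace-free symmetric `3 × 3` tensors:
  `‖A‖ ≤ 6 λ(A)` (elementary Rayleigh bounds on the entries: `−2λ ≤ A(i,i) ≤ λ`,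
  `|A(i,j)| ≤ 3λ/2`; the sharp constant `√6` is not needed), and its strain reading
  `TopEig.norm_strainFlat_le` for divergence-free fields on `T³`;
* `TopEig.lam_neg_strainFlat` — the BOTTOM eigenvalue through the same functional:
  `λ(−strainFlat v x) = −torusStrainBotEig v x` (tree `torusStrainTopEig_neg`), with
  `λ ∘ (−·)` convex, `1`-Lipschitz, non-negative and coercive on divergence-free strains
  (rows `ES.neglam3.q|T_C|C1`).

[ours; folklore linear algebra]
-/

noncomputable section

open Finset Set
open scoped Matrix

namespace Summit.NavierStokesRegularity.FunctionalMining

open Literature.Analysis.FunctionSpaces Literature.Analysis.FluidPDE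

namespace TopEig

variable {d : Type*} [Fintype d] [DecidableEq d]

/-! ## 1. `λ(A)` is the largest eigenvalue of a symmetric tensor -/

omit [DecidableEq d] in
/-- `eᵀAe` in matrix form: `quad A e = e ⬝ᵥ M *ᵥ e` when `A(i,j) = Mᵢⱼ`. [folklore] -/
theorem quad_eq_dotProduct_mulVec {A : EuclideanSpace ℝ (d × d)} {M : Matrix d d ℝ}
    (hAM : ∀ i j, A (i, j) = M i j) (e : d → ℝ) : quad A e = e ⬝ᵥ M *ᵥ e := by
  simp only [quad, dotProduct, Matrix.mulVec, Finset.mul_sum, hAM]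
  exact sum_congr rfl fun i _ => sum_congr rfl fun j _ => by ring

/-- **`λ(A) = λ_max(M)`** for a symmetric tensor: the top Rayleigh value is Mathlib's largest sorted
eigenvalue `eigenvalues₀ 0`. [folklore; Horn–Johnson 2013 Thm. 4.2.2 (c) via the tree's Ky Fan file] -/
theorem lam_eq_eigenvalues₀ [Nonempty d] {A : EuclideanSpace ℝ (d × d)} {M : Matrix d d ℝ}
    (hM : M.IsHermitian) (hAM : ∀ i j, A (i, j) = M i j) (hn : 1 ≤ Fintype.card d) :
    lam A = hM.eigenvalues₀ (Fin.castLE hn 0) := by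
  refine le_antisymm (lam_le fun e he => ?_) ?_
  · rw [quad_eq_dotProduct_mulVec hAM]
    have h := Literature.Analysis.Matrix.KyFan.dotProduct_mulVec_le_eigenvalues₀_max_mul hM hn e
    rw [he, mul_one] at h
    exact h
  · obtain ⟨h, horth, -, hsum⟩ :=
      Literature.Analysis.Matrix.KyFan.exists_frame_sum_rayleigh_eq hM (k := 1) hn
    simp only [Finset.univ_unique, Fin.default_eq_zero, Fin.isValue, sum_singleton] at hsum
    have h0 : h 0 ⬝ᵥ h 0 = 1 := by rw [horth 0 0, if_pos rfl]
    have hq : quad A (h 0) = hM.eigenvalues₀ (Fin.castLE hn 0) := by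
      rw [quad_eq_dotProduct_mulVec hAM, hsum]
    rw [← hq]
    exact quad_le_lam A h0

/-- The supremum of an antitone family on `Fin n` (`1 ≤ n`) is its value at `0`. [folklore] -/
theorem iSup_eq_apply_zero_of_antitone {n : ℕ} (hn : 1 ≤ n) {f : Fin n → ℝ} (hf : Antitone f) :
    (⨆ k, f k) = f (Fin.castLE hn 0) := by
  haveI : Nonempty (Fin n) := ⟨Fin.castLE hn 0⟩
  refine le_antisymm (ciSup_le fun k => hf (show Fin.castLE hn 0 ≤ k from Nat.zero_le _)) ?_
  exact le_ciSup (Set.finite_range f).bddAbove _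

/-- **`λ(strainFlat v x) = λ₁(x)`**, the dictionary's top strain eigenvalue density
(`torusStrainTopEig`, `StrainEigen.lean`). [ours, bookkeeping] -/
theorem lam_strainFlat [Nonempty d] (v : UnitAddTorus d → EuclideanSpace ℝ d) (x : UnitAddTorus d) :
    lam (StrainL4.strainFlat v x) = torusStrainTopEig v x := by
  have hn : 1 ≤ Fintype.card d := Fintype.card_pos
  have hAM : ∀ i j, StrainL4.strainFlat v x (i, j) = torusStrainMatrix v x i j := fun i j => by
    simp [StrainL4.strainFlat_apply, torusStrainMatrix]
  rw [lam_eq_eigenvalues₀ (torusStrainMatrix_isHermitian v x) hAM hn, torusStrainTopEig,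
    iSup_eq_apply_zero_of_antitone hn (torusStrainEig_antitone v x)]
  rfl

/-! ## 2. Coercivity on trace-free symmetric `3 × 3` tensors -/

/-- Diagonal entries of a trace-free `3 × 3` tensor lie in `[−2λ, λ]`. [folklore] -/
theorem diag_bounds {A : EuclideanSpace ℝ (Fin 3 × Fin 3)} (htr : ∑ i, A (i, i) = 0) (i : Fin 3) :
    A (i, i) ≤ lam A ∧ -(2 * lam A) ≤ A (i, i) := by
  refine ⟨apply_diag_le_lam A i, ?_⟩
  have h0 := apply_diag_le_lam A 0
  have h1 := apply_diag_le_lam A 1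
  have h2 := apply_diag_le_lam A 2
  simp only [Fin.sum_univ_three] at htr
  fin_cases i <;> simp <;> linarith

/-- Off-diagonal entries of a symmetric trace-free `3 × 3` tensor satisfy `|A(i,j)| ≤ 3λ/2`.
[folklore] -/
theorem abs_offdiag_le {A : EuclideanSpace ℝ (Fin 3 × Fin 3)} (hsym : ∀ i j, A (i, j) = A (j, i))
    (htr : ∑ i, A (i, i) = 0) {i j : Fin 3} (hij : i ≠ j) :
    |A (i, j)| ≤ 3 / 2 * lam A := by
  -- the third index `k` and `A(k,k) = −A(i,i) − A(j,j) ≤ λ`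
  have hk : ∃ k : Fin 3, k ≠ i ∧ k ≠ j ∧ A (k, k) = -(A (i, i) + A (j, j)) := by
    simp only [Fin.sum_univ_three] at htr
    fin_cases i <;> fin_cases j
    all_goals first
      | exact absurd rfl hij
      | exact ⟨0, by decide, by decide, by simp at htr ⊢; linarith⟩
      | exact ⟨1, by decide, by decide, by simp at htr ⊢; linarith⟩
      | exact ⟨2, by decide, by decide, by simp at htr ⊢; linarith⟩
  obtain ⟨k, -, -, hkk⟩ := hk
  have hkle : A (k, k) ≤ lam A := apply_diag_le_lam A k
  have hp := offdiag_le_lam A hij 1 (Or.inl rfl)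
  have hm := offdiag_le_lam A hij (-1) (Or.inr rfl)
  rw [hsym j i] at hp hm
  rw [abs_le]
  constructor <;> linarith

/-- **Coercivity**: for a symmetric trace-free `3 × 3` tensor, `‖A‖ ≤ 6 λ(A)` (Frobenius norm).
[folklore; the sharp constant is `√6`] -/
theorem norm_le_six_mul_lam {A : EuclideanSpace ℝ (Fin 3 × Fin 3)}
    (hsym : ∀ i j, A (i, j) = A (j, i)) (htr : ∑ i, A (i, i) = 0) : ‖A‖ ≤ 6 * lam A := by
  have hlam : 0 ≤ lam A := lam_nonneg_of_sum_diag_eq_zero A htr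
  -- every entry is bounded by `2λ` in absolute value
  have hentry : ∀ p : Fin 3 × Fin 3, A p ^ 2 ≤ (2 * lam A) ^ 2 := by
    rintro ⟨i, j⟩
    by_cases hij : i = j
    · subst hij
      obtain ⟨h1, h2⟩ := diag_bounds htr i
      nlinarith
    · have h := abs_offdiag_le hsym htr hij
      have h' : |A (i, j)| ≤ 2 * lam A := by linarith
      calc A (i, j) ^ 2 = |A (i, j)| ^ 2 := (sq_abs _).symm
        _ ≤ (2 * lam A) ^ 2 := pow_le_pow_left₀ (abs_nonneg _) h' 2
  have hsq : ‖A‖ ^ 2 ≤ (6 * lam A) ^ 2 := by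
    rw [EuclideanCoord.norm_sq_eq_sum_sq]
    calc ∑ p : Fin 3 × Fin 3, A p ^ 2 ≤ ∑ _p : Fin 3 × Fin 3, (2 * lam A) ^ 2 :=
          Finset.sum_le_sum fun p _ => hentry p
      _ = 9 * (2 * lam A) ^ 2 := by
          simp only [sum_const, card_univ, Fintype.card_prod, Fintype.card_fin, nsmul_eq_mul]
          norm_num
      _ = (6 * lam A) ^ 2 := by ring
  have h := abs_le_of_sq_le_sq hsq (by linarith)
  rwa [abs_of_nonneg (norm_nonneg _)] at h

/-! ## 3. The strain readings on `T³` -/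

variable {v : UnitAddTorus (Fin 3) → EuclideanSpace ℝ (Fin 3)}

/-- The flattened strain is symmetric. [ours] -/
theorem strainFlat_symm (v : UnitAddTorus d → EuclideanSpace ℝ d) (x : UnitAddTorus d) (i j : d) :
    StrainL4.strainFlat v x (i, j) = StrainL4.strainFlat v x (j, i) := by
  simp only [StrainL4.strainFlat_apply]; ring

/-- The flattened strain of a divergence-free field is trace-free: `∑ᵢ Sᵢᵢ = div v = 0`. [ours] -/
theorem sum_diag_strainFlat_eq_zero {v : UnitAddTorus d → EuclideanSpace ℝ d} (hv : Torus.IsSmooth v)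
    (hdiv : Torus.IsDivFree v) (x : UnitAddTorus d) : ∑ i, StrainL4.strainFlat v x (i, i) = 0 := by
  have h := torusStrainMatrix_trace_eq_zero hv hdiv x
  rw [torusStrainMatrix_trace] at h
  rw [← h]
  exact sum_congr rfl fun i _ => by simp [StrainL4.strainFlat_apply]

/-- `λ₁ ≥ 0` for divergence-free fields (any nonempty dimension). [ours] -/
theorem lam_strainFlat_nonneg [Nonempty d] {v : UnitAddTorus d → EuclideanSpace ℝ d}
    (hv : Torus.IsSmooth v) (hdiv : Torus.IsDivFree v) (x : UnitAddTorus d) :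
    0 ≤ lam (StrainL4.strainFlat v x) :=
  lam_nonneg_of_sum_diag_eq_zero _ (sum_diag_strainFlat_eq_zero hv hdiv x)

/-- **Coercivity of `λ₁` on `T³`**: `|S(x)| ≤ 6 λ₁(x)` for smooth divergence-free `v`. [ours] -/
theorem norm_strainFlat_le (hv : Torus.IsSmooth v) (hdiv : Torus.IsDivFree v) (x : UnitAddTorus (Fin 3)) :
    ‖StrainL4.strainFlat v x‖ ≤ 6 * lam (StrainL4.strainFlat v x) :=
  norm_le_six_mul_lam (strainFlat_symm v x) (sum_diag_strainFlat_eq_zero hv hdiv x)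

/-! ## 4. The bottom eigenvalue through `λ(−S)` -/

omit [DecidableEq d] in
/-- `A ↦ λ(−A)` is convex. [folklore] -/
theorem convexOn_lam_neg [Nonempty d] [DecidableEq d] :
    ConvexOn ℝ univ (fun A : EuclideanSpace ℝ (d × d) => lam (-A)) := by
  refine ⟨convex_univ, fun A _ B _ a b ha hb hab => ?_⟩
  have h := (convexOn_lam (d := d)).2 (mem_univ (-A)) (mem_univ (-B)) ha hb hab
  have e : a • -A + b • -B = -(a • A + b • B) := by rw [smul_neg, smul_neg, neg_add]
  rw [e] at h
  exact h

omit [DecidableEq d] in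
/-- `A ↦ λ(−A)` is `1`-Lipschitz. [folklore] -/
theorem lipschitzWith_lam_neg [Nonempty d] [DecidableEq d] :
    LipschitzWith 1 (fun A : EuclideanSpace ℝ (d × d) => lam (-A)) :=
  LipschitzWith.of_dist_le_mul fun A B => by
    have h := (lipschitzWith_lam (d := d)).dist_le_mul (-A) (-B)
    rwa [dist_neg_neg] at h

/-- `strainFlat (−v) = −strainFlat v`. [ours] -/
theorem strainFlat_neg (v : UnitAddTorus d → EuclideanSpace ℝ d) (x : UnitAddTorus d) :
    StrainL4.strainFlat (-v) x = -StrainL4.strainFlat v x := by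
  ext q
  rw [WithLp.ofLp_neg, Pi.neg_apply, StrainL4.strainFlat_apply, StrainL4.strainFlat_apply,
    show (-v) = fun y => -v y from rfl, Torus.partialDeriv_neg, Torus.partialDeriv_neg]
  simp only [WithLp.ofLp_neg, Pi.neg_apply]
  ring

/-- **`λ(−strainFlat v x) = −λ₃(x)`**, the dictionary's bottom strain eigenvalue density
(`torusStrainBotEig`). [ours, bookkeeping] -/
theorem lam_neg_strainFlat [Nonempty d] (v : UnitAddTorus d → EuclideanSpace ℝ d) (x : UnitAddTorus d) :
    lam (-StrainL4.strainFlat v x) = -torusStrainBotEig v x := by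
  rw [← strainFlat_neg, lam_strainFlat, torusStrainTopEig_neg]

/-- `−λ₃ ≥ 0` for divergence-free fields. [ours] -/
theorem lam_neg_strainFlat_nonneg [Nonempty d] {v : UnitAddTorus d → EuclideanSpace ℝ d}
    (hv : Torus.IsSmooth v) (hdiv : Torus.IsDivFree v) (x : UnitAddTorus d) :
    0 ≤ lam (-StrainL4.strainFlat v x) := by
  refine lam_nonneg_of_sum_diag_eq_zero _ ?_
  have h := sum_diag_strainFlat_eq_zero hv hdiv x
  simp only [WithLp.ofLp_neg, Pi.neg_apply, Finset.sum_neg_distrib, h, neg_zero]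

/-- **Coercivity of `−λ₃` on `T³`**: `|S(x)| ≤ 6 (−λ₃(x))` for smooth divergence-free `v`. [ours] -/
theorem norm_strainFlat_le_lam_neg (hv : Torus.IsSmooth v) (hdiv : Torus.IsDivFree v)
    (x : UnitAddTorus (Fin 3)) :
    ‖StrainL4.strainFlat v x‖ ≤ 6 * lam (-StrainL4.strainFlat v x) := by
  rw [← norm_neg]
  refine norm_le_six_mul_lam (fun i j => ?_) ?_
  · simp only [WithLp.ofLp_neg, Pi.neg_apply, strainFlat_symm v x i j]
  · have h := sum_diag_strainFlat_eq_zero hv hdiv x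
    simp only [WithLp.ofLp_neg, Pi.neg_apply, Finset.sum_neg_distrib, h, neg_zero]

end TopEig

end Summit.NavierStokesRegularity.FunctionalMining

end
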